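import Literature.Probability.Process.ItoIntegralLinearity
import Literature.Probability.Process.ItoIntegralIntegratorLinearity
import HarnessLib

/-!
# Scaling in the Itô characterisation: the simple process `c • H` and `∫ (cH) dB = c ∫ H dB`

Topic `Probability/Process`.  Completes the linearity bookkeeping of the tree's characterised Itô integral
(`ItoIntegralLinearity`: `±` in the integrand; `ItoIntegralNegation`: signs; `ItoIntegralIntegratorLinearity`: the integrator)
by REAL SCALAR MULTIPLES OF THE INTEGRAND:

* `SimpleProcess.smul` — the simple process `cH` (same partition, values `c·Hᵢ`), with `toProcess_smul`, `integral_smul`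
  (`(cH)·B = c(H·B)`), `IsApproxSeq.smul`;
* `IsItoIntegral.const_mul_left` — `IsItoIntegral H B J → IsItoIntegral (cH) B (cJ)` (local-martingale property of `cJ` as
  hypothesis, `_of_martingale` version; the case `c = 0` is `IsItoIntegral.sub h h`).

Revuz–Yor, Ch. IV, Def. (2.3) (`ℰ` is a vector space), eq. (2.4), Prop. (2.10)(i) (`K ↦ K·M` is linear).  Seat `ym-line-csu-p1`
g10 (brick «G2b» of gauge covariance in law of the SU(2) lattice Langevin dynamics: the conjugated solution's Itô integrals are
complex-linear combinations of the original ones).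

## References
* D. Revuz, M. Yor, *Continuous Martingales and Brownian Motion* (3rd ed., 1999), Ch. IV, Def. (2.3), eq. (2.4), Prop. (2.10)(i),
  Prop. (2.13).
-/

open MeasureTheory ProbabilityTheory Filter Finset
open scoped NNReal ENNReal Topology

noncomputable section

namespace Literature.Probability.Process

variable {Ω : Type*} {m : MeasurableSpace Ω}

namespace SimpleProcess

variable {𝓕 : Filtration ℝ≥0 m}

/-- The **scaled simple process** `cH`: same partition times, values `c·Hᵢ` (`ℰ` is a real vector space).
[cite: RevuzYor1999, Ch. IV Def. (2.3)] -/
def smul (c : ℝ) (H : SimpleProcess m 𝓕) : SimpleProcess m 𝓕 where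
  times := H.times
  sorted := H.sorted
  value i ω := c * H.value i ω
  measurable i h := (H.measurable i h).const_mul c
  bounded := by
    obtain ⟨C, hC⟩ := H.bounded
    refine ⟨|c| * C, fun i ω ↦ ?_⟩
    rw [abs_mul]
    exact mul_le_mul_of_nonneg_left (hC i ω) (abs_nonneg c)

/-- The partition times of `cH` are those of `H`. [cite: RevuzYor1999, Ch. IV Def. (2.3)] -/
@[simp]
theorem smul_time (c : ℝ) (H : SimpleProcess m 𝓕) (i : ℕ) : (H.smul c).time i = H.time i := rfl

/-- The values of `cH`. [cite: RevuzYor1999, Ch. IV Def. (2.3)] -/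
@[simp]
theorem smul_value (c : ℝ) (H : SimpleProcess m 𝓕) (i : ℕ) (ω : Ω) : (H.smul c).value i ω = c * H.value i ω := rfl

/-- The step process of `cH` is `c` times the step process of `H`. [cite: RevuzYor1999, Ch. IV Def. (2.3)] -/
theorem toProcess_smul (c : ℝ) (H : SimpleProcess m 𝓕) (t : ℝ≥0) (ω : Ω) :
    (H.smul c).toProcess t ω = c * H.toProcess t ω := by
  unfold toProcess
  rw [Finset.mul_sum]
  refine Finset.sum_congr (by rfl) fun i _ ↦ ?_
  rw [smul_time, smul_time]
  by_cases ht : t ∈ Set.Ioc (H.time i) (H.time (i + 1))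
  · simp only [Set.indicator_of_mem ht, smul_value]
  · simp only [Set.indicator_of_notMem ht, mul_zero]

/-- **`(cH)·B = c(H·B)`** for the elementary integral (pathwise). [cite: RevuzYor1999, Ch. IV eq. (2.4)] -/
theorem integral_smul (c : ℝ) (H : SimpleProcess m 𝓕) (B : ℝ≥0 → Ω → ℝ) (t : ℝ≥0) (ω : Ω) :
    (H.smul c).integral B t ω = c * H.integral B t ω := by
  unfold integral
  rw [Finset.mul_sum]
  refine Finset.sum_congr (by rfl) fun i _ ↦ ?_
  rw [smul_time, smul_time, smul_value, mul_assoc]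

/-- Approximating sequences scale: if `Hₙ → H` in `L²_loc(ds)` in probability then `cHₙ → cH`
(`(cHₙ − cH)² = c²(Hₙ − H)²`). [cite: RevuzYor1999, Ch. IV Prop. (2.13)] -/
theorem IsApproxSeq.smul {Hn : ℕ → SimpleProcess m 𝓕} {H : ℝ≥0 → Ω → ℝ} {P : Measure Ω}
    (h : IsApproxSeq Hn H P) (c : ℝ) : IsApproxSeq (fun n ↦ (Hn n).smul c) (fun t ω ↦ c * H t ω) P := by
  intro t ε hε
  have key : ∀ (n : ℕ) (ω : Ω) (s : ℝ),
      ENNReal.ofReal ((((Hn n).smul c).toProcess s.toNNReal ω - c * H s.toNNReal ω) ^ 2) =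
        ENNReal.ofReal (c ^ 2) * ENNReal.ofReal (((Hn n).toProcess s.toNNReal ω - H s.toNNReal ω) ^ 2) := by
    intro n ω s
    rw [toProcess_smul, ← mul_sub, mul_pow, ENNReal.ofReal_mul (sq_nonneg c)]
  simp_rw [key]
  by_cases hc : c = 0
  · -- the integrand vanishes: the events are empty
    have hempty : ∀ n, {ω | ENNReal.ofReal ε ≤ ∫⁻ s in Set.Icc (0 : ℝ) t,
        ENNReal.ofReal (c ^ 2) * ENNReal.ofReal (((Hn n).toProcess s.toNNReal ω - H s.toNNReal ω) ^ 2)} = ∅ := by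
      intro n
      ext ω
      simp only [hc, sq, mul_zero, ENNReal.ofReal_zero, zero_mul, lintegral_zero, Set.mem_setOf_eq,
        Set.mem_empty_iff_false, iff_false, not_le]
      exact ENNReal.ofReal_pos.mpr hε
    simp only [hempty, measure_empty]
    exact tendsto_const_nhds
  · have hc2 : 0 < c ^ 2 := by positivity
    have hset : ∀ n, {ω | ENNReal.ofReal ε ≤ ∫⁻ s in Set.Icc (0 : ℝ) t,
        ENNReal.ofReal (c ^ 2) * ENNReal.ofReal (((Hn n).toProcess s.toNNReal ω - H s.toNNReal ω) ^ 2)} =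
        {ω | ENNReal.ofReal (ε / c ^ 2) ≤ ∫⁻ s in Set.Icc (0 : ℝ) t,
          ENNReal.ofReal (((Hn n).toProcess s.toNNReal ω - H s.toNNReal ω) ^ 2)} := by
      intro n
      ext ω
      simp only [Set.mem_setOf_eq]
      rw [lintegral_const_mul' _ _ ENNReal.ofReal_ne_top, ENNReal.ofReal_div_of_pos hc2,
        ENNReal.div_le_iff (ENNReal.ofReal_pos.mpr hc2).ne' ENNReal.ofReal_ne_top, mul_comm]
    simp only [hset]
    exact h t (ε / c ^ 2) (div_pos hε hc2)

end SimpleProcess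

section Ito

variable {H B J : ℝ≥0 → Ω → ℝ} {𝓕 : Filtration ℝ≥0 m} {P : Measure Ω}

/-- ★ **`∫ (cH) dB = c ∫ H dB` in the Itô characterisation** (`c ≠ 0`; the local-martingale property of `cJ` as
hypothesis): approximating sequences of `cH` are exactly `c` times those of `H` (rescale by `c⁻¹`), and `(cHₙ)·B = c(Hₙ·B)`.
[cite: RevuzYor1999, Ch. IV Prop. (2.10)(i)] -/
theorem IsItoIntegral.const_mul_left_of_ne_zero (h : IsItoIntegral H B J 𝓕 P) {c : ℝ} (hc : c ≠ 0)
    (hLM : RandomPlanarGeometry.IsLocalMartingale (fun t ω ↦ c * J t ω) 𝓕 P) :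
    IsItoIntegral (fun t ω ↦ c * H t ω) B (fun t ω ↦ c * J t ω) 𝓕 P := by
  obtain ⟨h0, hcont, -, ⟨Hn, hHn⟩, hall⟩ := h
  refine ⟨fun ω ↦ by simp only [h0 ω, mul_zero], ?_, hLM, ⟨fun n ↦ (Hn n).smul c, hHn.smul c⟩,
    fun Gn hGn ↦ ?_⟩
  · filter_upwards [hcont] with ω hω
    exact continuous_const.mul hω
  · -- `c⁻¹ Gₙ` approximates `H`
    have h1 : SimpleProcess.IsApproxSeq (fun n ↦ (Gn n).smul c⁻¹) H P := by
      have := hGn.smul c⁻¹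
      simpa only [← mul_assoc, inv_mul_cancel₀ hc, one_mul] using this
    have h2 := (hall _ h1).const_mul c
    have h3 : (fun n ↦ (Gn n).integral B) = fun n t ω ↦ c * ((Gn n).smul c⁻¹).integral B t ω := by
      funext n t ω
      rw [SimpleProcess.integral_smul, ← mul_assoc, mul_inv_cancel₀ hc, one_mul]
    rw [h3]
    exact h2

/-- ★ **`∫ (cH) dB = c ∫ H dB` in the Itô characterisation**, all `c` (integrand with Borel paths; the local-martingale
property of `cJ` as hypothesis).  For `c = 0` this is `IsItoIntegral.sub h h`. [cite: RevuzYor1999, Ch. IV Prop. (2.10)(i)] -/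
theorem IsItoIntegral.const_mul_left (h : IsItoIntegral H B J 𝓕 P) (c : ℝ)
    (hH : ∀ ω, Measurable fun s : ℝ ↦ H s.toNNReal ω)
    (hLM : RandomPlanarGeometry.IsLocalMartingale (fun t ω ↦ c * J t ω) 𝓕 P) :
    IsItoIntegral (fun t ω ↦ c * H t ω) B (fun t ω ↦ c * J t ω) 𝓕 P := by
  by_cases hc : c = 0
  · subst hc
    have h0 := h.sub h hH hH (by simpa only [sub_self, zero_mul] using hLM)
    simpa only [sub_self, zero_mul] using h0
  · exact h.const_mul_left_of_ne_zero hc hLM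

/-- `IsItoIntegral.const_mul_left` for martingale integrals. [cite: RevuzYor1999, Ch. IV Prop. (2.10)(i)] -/
theorem IsItoIntegral.const_mul_left_of_martingale (h : IsItoIntegral H B J 𝓕 P) (c : ℝ)
    (hH : ∀ ω, Measurable fun s : ℝ ↦ H s.toNNReal ω) (hM : Martingale J 𝓕 P) :
    IsItoIntegral (fun t ω ↦ c * H t ω) B (fun t ω ↦ c * J t ω) 𝓕 P := by
  have hM' : Martingale (fun t ω ↦ c * J t ω) 𝓕 P := by
    have := hM.smul c
    simpa only [Pi.smul_def, smul_eq_mul] using this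
  exact h.const_mul_left c hH hM'.isLocalMartingale

end Ito

end Literature.Probability.Process

end
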